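import Literature.Probability.RandomPlanarGeometry.HexSAWRotStripIdentityY
import Literature.Probability.RandomPlanarGeometry.HexSAWRotStripLateralNull
import HarnessLib

/-!
# The lateral class with surface fugacity vanishes in the infinite-width limit, GIVEN the finiteness of the slab generating function
# (face Y3 of the lane's door R96 «BEATON-YC» reduced to ONE analytic input)

Topic `Literature/Probability/RandomPlanarGeometry`; lane «pcv-sawmu», door R96 (planner a-idea-1 g17, face **Y3 `RotELimZeroY`**; lead g10 r54
(α′)); prover a-p6 g7.  Source: N. R. Beaton, *The critical surface fugacity of self-avoiding walks on a rotated honeycomb lattice*,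
J. Phys. A 47 (2014) 075003 (arXiv:1210.0274v3), §4, Corollary 13 (p. 17: `E_T(x_c,y) := lim_L E_{T,L}(x_c,y) = 0` for `y < y†`, printed proof
through Corollary 10: the generating function `Ĉ_T` of the walks confined to the strip is finite) and the proof of Proposition 11 (the cut at
the last surface contact).

THE ONE ANALYTIC INPUT, typed as a face: **`RotSlabWalksSummable H₀`** — the number of `k`-step self-avoiding walks confined to Beaton's slab
`1 ≤ −ξ ≤ H₀` (the rotated / armchair-bounded strip of height `H₀`), weighted by `x_c^k`, has a summable majorant UNIFORM in the starting
vertex (Beaton, Corollary 10 with Lemma 12: `Ĉ_T(x_c, y) < ∞` for `y < y_T`, `y_T ≥ y† > 1`; equivalently the slab is sub-critical at `x_c`).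
It is NOT in the tree: the tree's `HexBW.stripConnectiveConstant_lt_hex` is the zigzag-bounded (parallel) family.

THE REDUCTION (this file): for `H ≥ 1`, `y > 0` and `sup_W B^{⊥,→}_{H,W}(y) ≤ K`,
`RotSlabWalksSummable (H − 1) → E^{⊥}_{H,W}(x_c, y) → 0` as `W → ∞` — i.e. the face `RotELimZeroY` at `(H, y)` from the slab face at height
`H − 1`.  Mechanism: walks with no surface contact are the lateral walks of `D(H−1, W)` at `y = 1` (→ 0 by `tendsto_rotStripLat_zero`); a walk
with a contact is cut at its LAST contact `v` — the head is a top-class walk of `D(H, W)` carrying all the `y`-weights (total mass `≤ K`), the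
tail is a self-avoiding walk in the slab of height `H − 1` from a neighbour of `v` to the lateral line, of length `≥ (3W − |X_v − 3|)/2 − 1`;
heads ending far from the lateral lines meet a small slab tail (summability), heads ending near them have small total mass (`W ↦ B_{H,W}(y)` is
non-decreasing and bounded, hence Cauchy).
-/

noncomputable section

open Finset Filter Topology

namespace Literature.Probability.RandomPlanarGeometry.SAW.HV

/-! ### The slab face -/

/-- The `k`-step self-avoiding walks from `s` confined to Beaton's slab `1 ≤ −ξ ≤ H₀` (vertex lists, `k + 1` vertices, all in the slab).
[cite: Beaton2014RotatedHoneycomb, §3 (walks in the strip of width T; the generating function Ĉ_T)] -/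
def slabSAWs (H₀ : ℕ) (s : HV) (k : ℕ) : Finset (List HV) :=
  (sawFin s k).filter fun l => ∀ u ∈ l, 1 ≤ -xi u ∧ -xi u ≤ H₀

/-- **FACE (the one analytic input) — the slab of height `H₀` is summable at `x_c`, uniformly in the start**: there is a summable
`F : ℕ → ℝ` with `#{k-step SAWs from s inside 1 ≤ −ξ ≤ H₀} · x_c^k ≤ F k` for every vertex `s` and every `k`.  (Beaton: `Ĉ_T(x_c, y) < ∞` for
`y < y_T`, Corollary 10, with `y_T ≥ y† > 1`, Lemma 12; uniformity in `s` by the translations `X ↦ X + 6` and the mirror of the slab.)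
NOT PROVED HERE. [cite: Beaton2014RotatedHoneycomb, §3, Corollary 10 (arXiv v3 p. 16) and §4, Lemma 12 (p. 17)] -/
def RotSlabWalksSummable (H₀ : ℕ) : Prop :=
  ∃ F : ℕ → ℝ, Summable F ∧ ∀ (s : HV) (k : ℕ), (#(slabSAWs H₀ s k) : ℝ) * hexCriticalFugacity ^ k ≤ F k

/-! ### No surface contact: the lateral walks of the shorter strip -/

/-- The lateral walks of `D(H₀+1, W) ∖ {a⁻}` WITHOUT contact with the top row `ξ = −(H₀+1)` are exactly the lateral walks of
`D(H₀, W) ∖ {a⁻}` (same list, same class). [cite: Beaton2014RotatedHoneycomb, §4, proof of Proposition 11 / Corollary 13] -/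
theorem filter_lat_noContact_eq (H₀ Wd : ℕ) :
    (midWalks ((rotStripV (H₀ + 1) Wd).erase wOut)).filter
        (fun P => IsRotLatDart (H₀ + 1) Wd (finalDart P) ∧ topContacts (H₀ + 1) P = 0) =
      (midWalks ((rotStripV H₀ Wd).erase wOut)).filter (fun P => IsRotLatDart H₀ Wd (finalDart P)) := by
  ext P
  simp only [mem_filter, mem_midWalks_iff, topContacts, List.countP_eq_zero, decide_eq_true_eq]
  constructor
  · rintro ⟨hP, ⟨h1, h2, h3, h4⟩, h0⟩
    have hmem : ∀ x ∈ inner P, x ∈ (rotStripV H₀ Wd).erase wOut := by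
      intro x hx
      have hx1 := hP.2.2.2.1 x hx
      rw [mem_erase, mem_rotStripV_iff] at hx1 ⊢
      refine ⟨hx1.1, ?_⟩
      rcases hx1.2 with h | h | ⟨ha, hb, hc⟩
      · exact Or.inl h
      · exact Or.inr (Or.inl h)
      · have h5 := h0 x hx
        push_cast at hb h5
        exact Or.inr (Or.inr ⟨ha, by omega, hc⟩)
    have hP' : IsMidWalk ((rotStripV H₀ Wd).erase wOut) P := ⟨hP.1, hP.2.1, hP.2.2.1, hmem, hP.2.2.2.2.1, hP.2.2.2.2.2⟩
    refine ⟨hP', h1, h2, ?_, h4⟩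
    -- the lateral dart starts at an inner vertex (or at `a⁻`/`a⁺`, impossible at height ≥ 1), whose height is ≤ H₀
    rcases hP.trivial_or_exists with rfl | ⟨l, u, hl, rfl⟩
    · rw [finalDart_trivial] at h2; simp [xi_wOut] at h2
    · rw [finalDart_cons_append hl] at h2 ⊢
      have hlast : l.getLast hl ∈ inner (wOut :: (l ++ [u])) := by
        rw [inner_cons_append]; exact List.getLast_mem hl
      have hx1 := hmem _ hlast
      rw [mem_erase, mem_rotStripV_iff] at hx1
      rcases hx1.2 with h | h | ⟨-, hb, -⟩
      · exact absurd h hx1.1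
      · simp only at h2; rw [h, xi_hvOrigin] at h2; omega
      · exact hb
  · rintro ⟨hP, ⟨h1, h2, h3, h4⟩⟩
    refine ⟨hP.mono (erase_subset_erase _ (rotStripV_mono_height (Nat.le_succ H₀))), ⟨h1, h2, ?_, h4⟩, fun x hx => ?_⟩
    · push_cast; omega
    · have hx1 := hP.2.2.2.1 x hx
      rw [mem_erase, mem_rotStripV_iff] at hx1
      rcases hx1.2 with h | h | ⟨-, hb, -⟩
      · exact absurd h hx1.1
      · rw [h, xi_hvOrigin]; push_cast; omega
      · push_cast; omega

/-- `E^{⊥}_{H₀+1,W}(y) = E^{⊥}_{H₀,W}(1) + Σ_{lateral walks of D(H₀+1,W) with a surface contact} x_c^ℓ y^c`.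
[cite: Beaton2014RotatedHoneycomb, §4, proof of Corollary 13] -/
theorem rotGFy_lat_eq_add (H₀ Wd : ℕ) (y : ℝ) :
    rotGFy ((rotStripV (H₀ + 1) Wd).erase wOut) (H₀ + 1) (IsRotLatDart (H₀ + 1) Wd) y =
      rotGF ((rotStripV H₀ Wd).erase wOut) (IsRotLatDart H₀ Wd) +
      ∑ P ∈ (midWalks ((rotStripV (H₀ + 1) Wd).erase wOut)).filter
          (fun P => IsRotLatDart (H₀ + 1) Wd (finalDart P) ∧ topContacts (H₀ + 1) P ≠ 0),
        hexCriticalFugacity ^ mwLen P * y ^ topContacts (H₀ + 1) P := by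
  rw [rotGFy, ← sum_filter_add_sum_filter_not _ (fun P => topContacts (H₀ + 1) P = 0), filter_filter, filter_filter]
  congr 1
  rw [filter_lat_noContact_eq, rotGF]
  refine sum_congr rfl fun P hP => ?_
  have h0 : topContacts (H₀ + 1) P = 0 :=
    (mem_filter.1 (filter_lat_noContact_eq H₀ Wd ▸ hP : P ∈ (midWalks ((rotStripV (H₀ + 1) Wd).erase wOut)).filter
      (fun P => IsRotLatDart (H₀ + 1) Wd (finalDart P) ∧ topContacts (H₀ + 1) P = 0))).2.2
  rw [h0, pow_zero, mul_one]

/-- In the degenerate strip of height `0` there is no lateral class: `E^{⊥}_{0,W} = 0`. [cite: Beaton2014RotatedHoneycomb, §2.2] -/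
theorem rotGF_lat_height_zero (Wd : ℕ) : rotGF ((rotStripV 0 Wd).erase wOut) (IsRotLatDart 0 Wd) = 0 := by
  rw [rotGF]
  refine sum_eq_zero fun P hP => ?_
  exfalso
  obtain ⟨hP, ⟨-, h2, h3, -⟩⟩ := mem_filter.1 hP
  push_cast at h3; omega

/-! ### The cut at the last surface contact, for LATERAL walks -/

variable {H Wd : ℕ}

/-- «not a top-row vertex of `D(H, ·)`». [folklore] -/
private def ntop (H : ℕ) (t : HV) : Bool := decide (xi t ≠ -(H : ℤ))
/-- inner list up to the last surface contact. [folklore] -/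
private def coreL (H : ℕ) (P : List HV) : List HV := (inner P).rdropWhile (ntop H)
/-- inner list after the last surface contact. [folklore] -/
private def tlL (H : ℕ) (P : List HV) : List HV := (inner P).rtakeWhile (ntop H)
/-- the last surface contact. [folklore] -/
private def topL (H : ℕ) (P : List HV) : HV := (coreL H P).getLast?.getD hvOrigin
/-- the exit vertex. [folklore] -/
private def exL (P : List HV) : HV := (finalDart P).2
/-- the head piece: up to the last contact, closed upward. [folklore] -/
private def headL (H : ℕ) (P : List HV) : List HV := wOut :: (coreL H P ++ [xiDown (topL H P)])
/-- the tail piece: after the last contact, through the exit vertex. [folklore] -/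
private def tailL (H : ℕ) (P : List HV) : List HV := tlL H P ++ [exL P]

/-- The tails are indexed by (first vertex, number of further steps): `{[t]}` for `k = 0`, the `k`-step slab walks of height `H − 1`
from `t` for `k ≥ 1`. [cite: Beaton2014RotatedHoneycomb, §4, proof of Proposition 11] -/
private def pieceL (H : ℕ) (p : HV × ℕ) : Finset (List HV) := if p.2 = 0 then {[p.1]} else slabSAWs (H - 1) p.1 p.2

/-- The admissible tail indices at the last contact `v` in width `W`: first vertex a neighbour of `v`, `k < #(D(H,W) ∖ {a⁻})` further
steps, and `3W − |X_v − 3| ≤ 2(k + 1)` (the tail must reach the lateral line). [cite: Beaton2014RotatedHoneycomb, §4, proof of Proposition 11] -/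
private def idxL (H Wd : ℕ) (v : HV) : Finset (HV × ℕ) :=
  ((HV.nbrs v).toFinset ×ˢ range #((rotStripV H Wd).erase wOut)).filter fun p => 3 * (Wd : ℤ) - |xX v - 3| ≤ 2 * ((p.2 : ℤ) + 1)

/-- The tail mass at the last contact `v`: `Σ_{(t,k) admissible} #pieces(t,k) · x_c^k`. [cite: Beaton2014RotatedHoneycomb, §4, proof of Proposition 11] -/
private def tailMassL (H Wd : ℕ) (v : HV) : ℝ := ∑ p ∈ idxL H Wd v, (#(pieceL H p) : ℝ) * hexCriticalFugacity ^ p.2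

/-- The cut datum of a lateral walk with a contact: (head, (first tail vertex, further tail steps), tail).
[cite: Beaton2014RotatedHoneycomb, §4, proof of Proposition 11] -/
private def cutL (H : ℕ) (P : List HV) : (_ : List HV) × (_ : HV × ℕ) × List HV :=
  ⟨headL H P, ((tailL H P).head?.getD hvOrigin, (tlL H P).length), tailL H P⟩

/-- Anatomy of a lateral walk of `D(H, W) ∖ {a⁻}` with a surface contact. [cite: Beaton2014RotatedHoneycomb, §4, proof of Proposition 11 (the last contact)] -/
private theorem anatomyL (hW : 1 ≤ Wd) {P : List HV} (hP : IsMidWalk ((rotStripV H Wd).erase wOut) P)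
    (hc : IsRotLatDart H Wd (finalDart P)) (ht : topContacts H P ≠ 0) :
    ∃ (l : List HV) (hl : l ≠ []), P = wOut :: (l ++ [exL P]) ∧ inner P = l ∧ coreL H P ++ tlL H P = l ∧ coreL H P ≠ [] ∧
      (coreL H P).getLast? = some (topL H P) ∧ xi (topL H P) = -(H : ℤ) ∧
      (∀ t ∈ tlL H P, xi t ≠ -(H : ℤ)) ∧ exL P ∉ l ∧
      ((tlL H P = [] → hvGraph.Adj (topL H P) (exL P) ∧ xi (exL P) = xi (topL H P)) ∧
        (∀ h0 : tlL H P ≠ [], hvGraph.Adj ((tlL H P).getLast h0) (exL P) ∧ xi (exL P) = xi ((tlL H P).getLast h0))) ∧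
      3 * (Wd : ℤ) ≤ |xX (exL P) - 3| ∧
      l.IsChain hvGraph.Adj ∧ l.head? = some hvOrigin ∧ hvGraph.Adj (l.getLast hl) (exL P) ∧
      (∀ x ∈ l, x ∈ (rotStripV H Wd).erase wOut) ∧ l.Nodup := by
  rcases hP.trivial_or_exists with rfl | ⟨l, u, hl, rfl⟩
  · exfalso; apply ht; simp [topContacts, inner]
  obtain ⟨hch, hhd, hadj, hV, hnd, -⟩ := (isMidWalk_cons_append_iff _ hl u).1 hP
  have hex : exL (wOut :: (l ++ [u])) = u := by simp [exL, finalDart_cons_append hl]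
  have hin : inner (wOut :: (l ++ [u])) = l := inner_cons_append l u
  have hsplit : coreL H (wOut :: (l ++ [u])) ++ tlL H (wOut :: (l ++ [u])) = l := by
    rw [coreL, tlL, hin]; exact List.rdropWhile_append_rtakeWhile
  have htl_top : ∀ t ∈ tlL H (wOut :: (l ++ [u])), xi t ≠ -(H : ℤ) := by
    intro t htm
    have := List.mem_rtakeWhile_imp (p := ntop H) (l := inner (wOut :: (l ++ [u]))) (by rw [← tlL]; exact htm)
    simpa [ntop] using this
  have hcore : coreL H (wOut :: (l ++ [u])) ≠ [] := by
    intro h0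
    have htl : tlL H (wOut :: (l ++ [u])) = l := by simpa [h0] using hsplit
    apply ht
    rw [topContacts, hin, List.countP_eq_zero]
    intro t htm
    have := htl_top t (by rw [htl]; exact htm)
    simpa using this
  have hlast : (coreL H (wOut :: (l ++ [u]))).getLast? = some (topL H (wOut :: (l ++ [u]))) := by
    rw [topL, List.getLast?_eq_some_getLast hcore]; rfl
  have hv : (coreL H (wOut :: (l ++ [u]))).getLast hcore = topL H (wOut :: (l ++ [u])) := by
    rw [List.getLast?_eq_some_getLast hcore, Option.some_inj] at hlast; exact hlast
  have hvxi : xi (topL H (wOut :: (l ++ [u]))) = -(H : ℤ) := by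
    have h1 := List.rdropWhile_last_not (p := ntop H) (l := inner (wOut :: (l ++ [u]))) (by rw [← coreL]; exact hcore)
    rw [← hv]; simpa [ntop, coreL] using h1
  obtain ⟨hc1, hc2, hc3, hc4⟩ := hc
  rw [finalDart_cons_append hl] at hc1 hc2 hc3 hc4
  simp only at hc1 hc2 hc3 hc4
  -- the exit vertex is outside `D(H, W)` laterally, hence not an inner vertex
  have hWd : (0 : ℤ) ≤ Wd := by positivity
  have hu_notin : u ∉ l := by
    intro hu
    have h2 := hV u hu
    rw [mem_erase, mem_rotStripV_iff] at h2
    rcases h2.2 with h | h | ⟨-, -, h⟩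
    · exact h2.1 h
    · rw [h, xX_hvOrigin] at hc4; norm_num at hc4
      have hW1 : (1:ℤ) ≤ Wd := by exact_mod_cast hW
      omega
    · omega
  -- the exit vertex hangs off the last vertex of `v :: tl`, at the same height
  have hxu : (tlL H (wOut :: (l ++ [u])) = [] → hvGraph.Adj (topL H (wOut :: (l ++ [u]))) u ∧ xi u = xi (topL H (wOut :: (l ++ [u])))) ∧
      (∀ h0 : tlL H (wOut :: (l ++ [u])) ≠ [], hvGraph.Adj ((tlL H (wOut :: (l ++ [u]))).getLast h0) u ∧
        xi u = xi ((tlL H (wOut :: (l ++ [u]))).getLast h0)) := by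
    constructor
    · intro h0
      have hcl : coreL H (wOut :: (l ++ [u])) = l := by simpa [h0] using hsplit
      have : l.getLast hl = topL H (wOut :: (l ++ [u])) := by rw [← hv]; congr 1; exact hcl.symm
      rw [← this]; exact ⟨hadj, hc1⟩
    · intro h0
      have key : ∀ (c t : List HV) (hl' : c ++ t ≠ []) (h0' : t ≠ []), (c ++ t).getLast hl' = t.getLast h0' :=
        fun c t hl' h0' => List.getLast_append_of_ne_nil _ h0'
      have : l.getLast hl = (tlL H (wOut :: (l ++ [u]))).getLast h0 := by
        have e := key (coreL H (wOut :: (l ++ [u]))) (tlL H (wOut :: (l ++ [u]))) (by rw [hsplit]; exact hl) h0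
        rw [← e]; congr 1; exact hsplit.symm
      rw [← this]; exact ⟨hadj, hc1⟩
  refine ⟨l, hl, by rw [hex], hin, hsplit, hcore, hlast, hvxi, htl_top, by rw [hex]; exact hu_notin, by rw [hex]; exact hxu,
    by rw [hex]; exact hc4, hch, hhd, by rw [hex]; exact hadj, hV, hnd⟩

/-- Heights and abscissae of the TAIL vertices: `1 ≤ −ξ ≤ H − 1` and `|X − 3| < 3W`; `a⁺` is in the core.
[cite: Beaton2014RotatedHoneycomb, §4, proof of Proposition 11] -/
private theorem tail_boundsL (hW : 1 ≤ Wd) {P : List HV} (hP : IsMidWalk ((rotStripV H Wd).erase wOut) P)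
    (hc : IsRotLatDart H Wd (finalDart P)) (ht : topContacts H P ≠ 0) :
    (∀ x ∈ tlL H P, 1 ≤ -xi x ∧ -xi x ≤ (H : ℤ) - 1 ∧ |xX x - 3| < 3 * Wd ∧ x ≠ hvOrigin ∧ x ≠ wOut) ∧ hvOrigin ∈ coreL H P := by
  obtain ⟨l, hl, -, -, hsplit, hcore, -, -, htl_top, -, -, -, -, hhd, -, hV, hnd⟩ := anatomyL hW hP hc ht
  have hO_c : hvOrigin ∈ coreL H P := by
    cases hc' : coreL H P with
    | nil => exact absurd hc' hcore
    | cons a c' =>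
      rw [← hsplit, hc', List.cons_append, List.head?_cons, Option.some_inj] at hhd
      rw [hhd]; exact List.mem_cons_self
  refine ⟨fun x hx => ?_, hO_c⟩
  have hxO : x ≠ hvOrigin := by
    intro h; rw [← hsplit] at hnd; exact (List.disjoint_of_nodup_append hnd) hO_c (h ▸ hx)
  have h2 := hV x (hsplit ▸ List.mem_append_right _ hx)
  rw [mem_erase, mem_rotStripV_iff] at h2
  rcases h2.2 with h3 | h3 | ⟨h3, h4, h5⟩
  · exact absurd h3 h2.1
  · exact absurd h3 hxO
  · have h6 := htl_top x hx
    exact ⟨h3, by omega, h5, hxO, h2.1⟩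

/-- **The head piece is a top-class walk of `D(H, W)` with the same contacts**, of length `|core|`.
[cite: Beaton2014RotatedHoneycomb, §4, proof of Proposition 11 (the first piece is a B-walk)] -/
private theorem headL_spec (hH : 1 ≤ H) (hW : 1 ≤ Wd) {P : List HV} (hP : IsMidWalk ((rotStripV H Wd).erase wOut) P)
    (hc : IsRotLatDart H Wd (finalDart P)) (ht : topContacts H P ≠ 0) :
    IsMidWalk ((rotStripV H Wd).erase wOut) (headL H P) ∧ IsRotTopDart H (finalDart (headL H P)) ∧
      mwLen (headL H P) = (coreL H P).length ∧ topContacts H (headL H P) = topContacts H P ∧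
      (finalDart (headL H P)).1 = topL H P ∧ mwLen P = mwLen (headL H P) + (tlL H P).length := by
  obtain ⟨l, hl, hPeq, hin, hsplit, hcore, hlast, hvxi, htl_top, -, -, -, hch, hhd, -, hV, hnd⟩ := anatomyL hW hP hc ht
  have hcl : (coreL H P).getLast hcore = topL H P := by
    rw [List.getLast?_eq_some_getLast hcore, Option.some_inj] at hlast; exact hlast
  have hchc : (coreL H P).IsChain hvGraph.Adj := by rw [← hsplit] at hch; exact (List.isChain_append.1 hch).1
  have hhdc : (coreL H P).head? = some hvOrigin := by
    rw [← hsplit, List.head?_append_of_ne_nil _ hcore] at hhd; exact hhd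
  have hVc : ∀ x ∈ coreL H P, x ∈ (rotStripV H Wd).erase wOut := fun x hx => hV x (hsplit ▸ List.mem_append_left _ hx)
  have hndc : (coreL H P).Nodup := by rw [← hsplit] at hnd; exact hnd.of_append_left
  have hup : hvGraph.Adj (topL H P) (xiDown (topL H P)) := adj_xiDown _
  have hxiup : xi (xiDown (topL H P)) = -(H : ℤ) - 1 := by rw [xi_xiDown, hvxi]
  have hH0 : (0 : ℤ) ≤ H := by positivity
  have hprev : xiDown (topL H P) ≠ prevOf (coreL H P) := by
    intro h
    have hmem : prevOf (coreL H P) ∈ wOut :: (coreL H P).dropLast := by rw [prevOf]; exact List.getLast_mem _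
    rw [← h, List.mem_cons] at hmem
    rcases hmem with h1 | h1
    · have := congrArg xi h1; rw [hxiup, xi_wOut] at this; omega
    · have h2 := hVc _ (List.dropLast_subset _ h1)
      rw [mem_erase, mem_rotStripV_iff] at h2
      rcases h2.2 with h3 | h3 | ⟨-, h3, -⟩
      · exact h2.1 h3
      · have := congrArg xi h3; rw [hxiup, xi_hvOrigin] at this; omega
      · rw [hxiup] at h3; omega
  have hmw : IsMidWalk ((rotStripV H Wd).erase wOut) (headL H P) :=
    (isMidWalk_cons_append_iff _ hcore _).2 ⟨hchc, hhdc, by rw [hcl]; exact hup, hVc, hndc, hprev⟩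
  refine ⟨hmw, ?_, ?_, ?_, ?_, ?_⟩
  · rw [headL, finalDart_cons_append hcore, hcl]; exact ⟨hvxi, hxiup⟩
  · rw [headL, mwLen_cons_append]
  · have h0 : (tlL H P).countP (fun w => xi w = -(H : ℤ)) = 0 := by
      rw [List.countP_eq_zero]; intro w hw; simpa using htl_top w hw
    rw [topContacts, topContacts, headL, inner_cons_append, hin, ← hsplit, List.countP_append, h0, add_zero]
  · rw [headL, finalDart_cons_append hcore, hcl]
  · rw [headL, mwLen_cons_append, ← hP.length_inner, hin, ← hsplit, List.length_append]

/-- **The tail piece**: `v :: tail` is a self-avoiding lattice path, `tail ≠ []`, its vertices other than possibly the exit vertex lie in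
the slab `1 ≤ −ξ ≤ H−1` inside the width, the exit vertex is laterally outside (`|X − 3| ≥ 3W`) at the height of the previous vertex, and the
walk needs `2·|tail| ≥ 3W − |X_v − 3|` steps to get there. [cite: Beaton2014RotatedHoneycomb, §4, proof of Proposition 11] -/
private theorem tailL_spec (hH : 1 ≤ H) (hW : 1 ≤ Wd) {P : List HV} (hP : IsMidWalk ((rotStripV H Wd).erase wOut) P)
    (hc : IsRotLatDart H Wd (finalDart P)) (ht : topContacts H P ≠ 0) :
    (topL H P :: tailL H P).IsChain hvGraph.Adj ∧ (topL H P :: tailL H P).Nodup ∧ tailL H P ≠ [] ∧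
      |xX (topL H P) - 3| < 3 * Wd ∧ 3 * (Wd : ℤ) - |xX (topL H P) - 3| ≤ 2 * (((tlL H P).length : ℤ) + 1) ∧
      (tlL H P).length < #((rotStripV H Wd).erase wOut) ∧
      ∃ t₁, (tailL H P).head? = some t₁ ∧ hvGraph.Adj (topL H P) t₁ ∧ tailL H P ∈ pieceL H (t₁, (tlL H P).length) := by
  obtain ⟨l, hl, hPeq, hin, hsplit, hcore, hlast, hvxi, htl_top, hw_notin, hxw, hfar, hch, hhd, hadj, hV, hnd⟩ := anatomyL hW hP hc ht
  obtain ⟨htail, hOc⟩ := tail_boundsL hW hP hc ht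
  have hcl : (coreL H P).getLast hcore = topL H P := by
    rw [List.getLast?_eq_some_getLast hcore, Option.some_inj] at hlast; exact hlast
  have hvmem : topL H P ∈ coreL H P := hcl ▸ List.getLast_mem hcore
  have hvV : topL H P ∈ (rotStripV H Wd).erase wOut := hV _ (hsplit ▸ List.mem_append_left _ hvmem)
  have hvX : |xX (topL H P) - 3| < 3 * Wd := by
    rw [mem_erase, mem_rotStripV_iff] at hvV
    rcases hvV.2 with h | h | ⟨-, -, h⟩
    · exact absurd h hvV.1
    · exfalso
      have h1 := congrArg xi h
      rw [hvxi, xi_hvOrigin] at h1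
      have h2 : (1:ℤ) ≤ H := by exact_mod_cast hH
      omega
    · exact h
  -- the two junction adjacencies and the chain `v :: tl ++ [w]`
  have hcht : (coreL H P ++ tlL H P).IsChain hvGraph.Adj := by rw [hsplit]; exact hch
  have hadj_vt : ∀ t₁ t', tlL H P = t₁ :: t' → hvGraph.Adj (topL H P) t₁ := fun t₁ t' htt =>
    (List.isChain_append.1 hcht).2.2 _ (by rw [hlast]; exact Option.mem_some_iff.mpr rfl) _ (by rw [htt]; rfl)
  have hchain : (topL H P :: tailL H P).IsChain hvGraph.Adj := by
    rw [tailL, List.isChain_cons]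
    constructor
    · intro b hb
      by_cases h0 : tlL H P = []
      · rw [h0, List.nil_append] at hb
        simp only [List.head?_cons, Option.mem_def, Option.some_inj] at hb
        subst hb; exact (hxw.1 h0).1
      · obtain ⟨t₁, t', htt⟩ := List.exists_cons_of_ne_nil h0
        rw [htt, List.cons_append, List.head?_cons, Option.mem_def, Option.some_inj] at hb
        subst hb; exact hadj_vt t₁ t' htt
    · rw [List.isChain_append]
      refine ⟨(List.isChain_append.1 hcht).2.1, List.isChain_singleton _, fun x hx y hy => ?_⟩
      simp only [List.head?_cons, Option.mem_def, Option.some_inj] at hy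
      subst hy
      have h0 : tlL H P ≠ [] := by rintro h0; rw [h0] at hx; simp at hx
      rw [List.getLast?_eq_some_getLast h0, Option.mem_def, Option.some_inj] at hx
      subst hx; exact (hxw.2 h0).1
  have hnodup : (topL H P :: tailL H P).Nodup := by
    rw [tailL, List.nodup_cons, List.nodup_append]
    have hndt : (tlL H P).Nodup := by rw [← hsplit] at hnd; exact hnd.of_append_right
    refine ⟨?_, hndt, List.nodup_singleton _, ?_⟩
    · rw [List.mem_append, List.mem_singleton, not_or]
      constructor
      · intro hvt; rw [← hsplit] at hnd; exact (List.disjoint_of_nodup_append hnd) hvmem hvt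
      · intro hve; apply hw_notin; rw [← hve]; exact hsplit ▸ List.mem_append_left _ hvmem
    · intro x hx y hy hxy
      rw [List.mem_singleton] at hy; subst hy; subst hxy
      exact hw_notin (hsplit ▸ List.mem_append_right _ hx)
  have hne : tailL H P ≠ [] := by simp [tailL]
  -- the length bound: each step moves `X` by at most 2
  have hsteps : ∀ (L : List HV) (a : HV), (a :: L).IsChain hvGraph.Adj → |xX ((a :: L).getLast (List.cons_ne_nil _ _)) - xX a| ≤ 2 * L.length := by
    intro L
    induction L with
    | nil => intro a _; simp
    | cons b L ih =>
      intro a hchL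
      have hab : hvGraph.Adj a b := (List.isChain_cons_cons.1 hchL).1
      have hrest := ih b (List.isChain_cons_cons.1 hchL).2
      have h1 := abs_xX_sub_le_of_adj hab
      rw [List.getLast_cons (List.cons_ne_nil _ _)]
      have := abs_sub_le (xX ((b :: L).getLast (List.cons_ne_nil _ _))) (xX b) (xX a)
      simp only [List.length_cons]; push_cast; linarith
  have hlastw : (topL H P :: tailL H P).getLast (List.cons_ne_nil _ _) = exL P := by
    simp [tailL]
  have hlen : 3 * (Wd : ℤ) - |xX (topL H P) - 3| ≤ 2 * (tailL H P).length := by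
    have h1 := hsteps (tailL H P) (topL H P) hchain
    rw [hlastw] at h1
    have h2 := abs_sub_abs_le_abs_sub (xX (exL P) - 3) (xX (topL H P) - 3)
    have : xX (exL P) - 3 - (xX (topL H P) - 3) = xX (exL P) - xX (topL H P) := by ring
    rw [this] at h2
    linarith
  have hlen' : 3 * (Wd : ℤ) - |xX (topL H P) - 3| ≤ 2 * (((tlL H P).length : ℤ) + 1) := by
    rw [tailL, List.length_append, List.length_singleton] at hlen; push_cast at hlen; exact hlen
  have hN : (tlL H P).length < #((rotStripV H Wd).erase wOut) := by
    have h1 := hP.mwLen_le_card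
    rw [← hP.length_inner, hin, ← hsplit, List.length_append] at h1
    have h2 : 1 ≤ (coreL H P).length := List.length_pos_iff.2 hcore
    omega
  refine ⟨hchain, hnodup, hne, hvX, hlen', hN, ?_⟩
  by_cases h0 : tlL H P = []
  · refine ⟨exL P, by rw [tailL, h0, List.nil_append]; rfl, (hxw.1 h0).1, ?_⟩
    simp [pieceL, tailL, h0]
  · obtain ⟨t₁, t', htt⟩ := List.exists_cons_of_ne_nil h0
    refine ⟨t₁, by rw [tailL, htt]; rfl, hadj_vt t₁ t' htt, ?_⟩
    have hk : (tlL H P).length ≠ 0 := by rw [htt]; simp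
    rw [pieceL, if_neg hk]
    -- `tail = t₁ :: (t' ++ [w])` is a `|tl|`-step SAW from `t₁` inside the slab of height `H-1`
    rw [slabSAWs, mem_filter, mem_sawFin_iff, mem_sawLists_iff]
    have hch2 : (tailL H P).IsChain hvGraph.Adj := (List.isChain_cons.1 hchain).2
    refine ⟨⟨hch2, by rw [tailL, htt]; rfl, by rw [tailL, List.length_append, List.length_singleton], (List.nodup_cons.1 hnodup).2⟩, ?_⟩
    intro u hu
    rw [tailL, List.mem_append, List.mem_singleton] at hu
    rcases hu with hu | rfl
    · obtain ⟨a1, a2, -⟩ := htail u hu; exact ⟨a1, by omega⟩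
    · -- the exit vertex has the height of the last tail vertex
      obtain ⟨a1, a2, -⟩ := htail _ (List.getLast_mem h0)
      rw [(hxw.2 h0).2]; exact ⟨a1, by omega⟩

/-- The walk is recovered from its cut datum: `P = a⁻ :: (core ++ tail)` with `core = (head.tail).dropLast`.
[cite: Beaton2014RotatedHoneycomb, §4, proof of Proposition 11] -/
private theorem cutL_eq (hW : 1 ≤ Wd) {P : List HV} (hP : IsMidWalk ((rotStripV H Wd).erase wOut) P)
    (hc : IsRotLatDart H Wd (finalDart P)) (ht : topContacts H P ≠ 0) :
    P = wOut :: ((headL H P).tail.dropLast ++ tailL H P) := by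
  obtain ⟨l, hl, hPeq, -, hsplit, -⟩ := anatomyL hW hP hc ht
  have h1 : (headL H P).tail.dropLast = coreL H P := by simp [headL]
  rw [h1, tailL, ← List.append_assoc, hsplit]; exact hPeq

/-! ### The cut inequality -/

/-- **The lateral cut inequality**: `Σ_{lateral walks of D(H,W)∖{a⁻} with a contact} x_c^ℓ y^c ≤ Σ_{top walks π} x_c^{ℓ(π)} y^{c(π)} ·
tailMass(v_π)`, `v_π` the top vertex of `π` (`H, W ≥ 1`, `y ≥ 0`). [cite: Beaton2014RotatedHoneycomb, §4, proof of Proposition 11 and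
Corollary 13] -/
private theorem lat_cut_le (hH : 1 ≤ H) (hW : 1 ≤ Wd) {y : ℝ} (hy : 0 ≤ y) :
    ∑ P ∈ (midWalks ((rotStripV H Wd).erase wOut)).filter (fun P => IsRotLatDart H Wd (finalDart P) ∧ topContacts H P ≠ 0),
        hexCriticalFugacity ^ mwLen P * y ^ topContacts H P ≤
      ∑ π ∈ (midWalks ((rotStripV H Wd).erase wOut)).filter (fun P => IsRotTopDart H (finalDart P)),
        hexCriticalFugacity ^ mwLen π * y ^ topContacts H π * tailMassL H Wd (finalDart π).1 := by
  have hx := hexCriticalFugacity_pos_lt_one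
  set V := (rotStripV H Wd).erase wOut with hV
  set S := (midWalks V).filter (fun P => IsRotLatDart H Wd (finalDart P) ∧ topContacts H P ≠ 0) with hS
  set T := (midWalks V).filter (fun P => IsRotTopDart H (finalDart P)) with hT
  set g : (_ : List HV) × (_ : HV × ℕ) × List HV → ℝ := fun q =>
    hexCriticalFugacity ^ mwLen q.1 * y ^ topContacts H q.1 * hexCriticalFugacity ^ q.2.1.2 with hg
  have hmem : ∀ P ∈ S, IsMidWalk V P ∧ IsRotLatDart H Wd (finalDart P) ∧ topContacts H P ≠ 0 := fun P hP => by
    have h := mem_filter.1 hP; exact ⟨mem_midWalks_iff.1 h.1, h.2.1, h.2.2⟩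
  -- termwise: the weight of `P` is `g (cutL P)`
  have hterm : ∀ P ∈ S, hexCriticalFugacity ^ mwLen P * y ^ topContacts H P = g (cutL H P) := by
    intro P hP
    obtain ⟨h1, h2, h3⟩ := hmem P hP
    obtain ⟨-, -, -, htc, -, hlen⟩ := headL_spec hH hW h1 h2 h3
    simp only [hg, cutL]
    rw [htc, hlen, pow_add]; ring
  rw [sum_congr rfl hterm]
  -- the cut is injective on `S`
  have hinj : Set.InjOn (cutL H) ↑S := by
    intro P hP P' hP' h
    obtain ⟨h1, h2, h3⟩ := hmem P (Finset.mem_coe.1 hP)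
    obtain ⟨h1', h2', h3'⟩ := hmem P' (Finset.mem_coe.1 hP')
    simp only [cutL, Sigma.mk.injEq, heq_eq_eq, Prod.mk.injEq] at h
    obtain ⟨hh, -, ht⟩ := h
    rw [cutL_eq hW h1 h2 h3, cutL_eq hW h1' h2' h3', hh, ht]
  -- … and lands in the sigma-set of (top walk, admissible index, piece)
  have himg : S.image (cutL H) ⊆ T.sigma fun π => (idxL H Wd (finalDart π).1).sigma fun p => pieceL H p := by
    intro q hq
    obtain ⟨P, hP, rfl⟩ := mem_image.1 hq
    obtain ⟨h1, h2, h3⟩ := hmem P hP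
    obtain ⟨a1, a2, -, -, a5, -⟩ := headL_spec hH hW h1 h2 h3
    obtain ⟨-, -, -, -, b5, b6, t₁, b7, b8, b9⟩ := tailL_spec hH hW h1 h2 h3
    refine mem_sigma.2 ⟨mem_filter.2 ⟨mem_midWalks_iff.2 a1, a2⟩, mem_sigma.2 ⟨?_, ?_⟩⟩
    · show ((tailL H P).head?.getD hvOrigin, (tlL H P).length) ∈ idxL H Wd (finalDart (headL H P)).1
      rw [a5, idxL, mem_filter, mem_product, b7]
      exact ⟨⟨List.mem_toFinset.2 ((hvGraph_adj_iff_mem_nbrs _ _).1 b8), mem_range.2 b6⟩, b5⟩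
    · show tailL H P ∈ pieceL H ((tailL H P).head?.getD hvOrigin, (tlL H P).length)
      rw [b7]; exact b9
  have hg0 : ∀ q, 0 ≤ g q := fun q => by
    simp only [hg]; exact mul_nonneg (mul_nonneg (pow_nonneg hx.1.le _) (pow_nonneg hy _)) (pow_nonneg hx.1.le _)
  calc ∑ P ∈ S, g (cutL H P) = ∑ q ∈ S.image (cutL H), g q := (sum_image hinj).symm
    _ ≤ ∑ q ∈ T.sigma (fun π => (idxL H Wd (finalDart π).1).sigma fun p => pieceL H p), g q :=
        sum_le_sum_of_subset_of_nonneg himg fun q _ _ => hg0 q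
    _ = _ := by
        rw [sum_sigma]
        refine sum_congr rfl fun π _ => ?_
        rw [sum_sigma, tailMassL, mul_sum]
        refine sum_congr rfl fun p _ => ?_
        simp only [hg, sum_const, nsmul_eq_mul]
        ring

/-- For a top walk `π` of `D(H, W) ∖ {a⁻}` (`H ≥ 1`) the top vertex is laterally inside: `|X_{v_π} − 3| < 3W`.
[cite: Beaton2014RotatedHoneycomb, §2.2] -/
private theorem topV_lt (hH : 1 ≤ H) {π : List HV} (hπ : IsMidWalk ((rotStripV H Wd).erase wOut) π)
    (hc : IsRotTopDart H (finalDart π)) : |xX (finalDart π).1 - 3| < 3 * Wd := by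
  have hH1 : (1 : ℤ) ≤ H := by exact_mod_cast hH
  have hne : π ≠ [wOut, hvOrigin] := by
    rintro rfl
    have h1 := hc.1
    rw [finalDart_trivial, xi_wOut] at h1
    omega
  have hv := finalDart_fst_mem hπ hne
  rw [mem_erase, mem_rotStripV_iff] at hv
  rcases hv.2 with h | h | ⟨-, -, h⟩
  · exact absurd h hv.1
  · exfalso; have h1 := hc.1; rw [h, xi_hvOrigin] at h1; omega
  · exact h

/-- The explicit neighbour list has three entries. [folklore] -/
private theorem nbrs_length (v : HV) : (HV.nbrs v).length = 3 := by
  obtain ⟨a, b, c⟩ := v; cases c <;> rfl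

/-- **The tail mass is small far from the lateral lines**: with `F` the majorant of the slab face (height `H − 1`) and
`G := F[0 ↦ 1]`, `tailMass_W(v) ≤ 3 · Σ_{j} G(j + m)` whenever `2m + 1 ≤ 3W − |X_v − 3|`. [cite: Beaton2014RotatedHoneycomb, §4, proof of
Corollary 13 (finiteness of the strip generating function, Corollary 10)] -/
private theorem tailMassL_le {F : ℕ → ℝ} (hF : ∀ (s : HV) (k : ℕ), (#(slabSAWs (H - 1) s k) : ℝ) * hexCriticalFugacity ^ k ≤ F k)
    (hFs : Summable F) {v : HV} {m : ℕ} (hm : 2 * (m : ℤ) + 1 ≤ 3 * (Wd : ℤ) - |xX v - 3|) :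
    tailMassL H Wd v ≤ 3 * ∑' j, Function.update F 0 1 (j + m) := by
  have hx := hexCriticalFugacity_pos_lt_one
  set G := Function.update F 0 1 with hG
  have hpiece : ∀ p : HV × ℕ, (#(pieceL H p) : ℝ) * hexCriticalFugacity ^ p.2 ≤ G p.2 := by
    rintro ⟨t, k⟩
    by_cases hk : k = 0
    · subst hk; simp [pieceL, hG]
    · simp only [pieceL, if_neg hk, hG, Function.update_of_ne hk]; exact hF t k
  have hG0 : ∀ k, 0 ≤ G k := fun k => by
    by_cases hk : k = 0
    · subst hk; simp [hG]
    · rw [hG, Function.update_of_ne hk]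
      exact (mul_nonneg (Nat.cast_nonneg _) (pow_nonneg hx.1.le _)).trans (hF hvOrigin k)
  have hGs : Summable G := hFs.update 0 1
  set g' : ℕ → ℝ := fun k => if m ≤ k then G k else 0 with hg'
  have hg'0 : ∀ k, 0 ≤ g' k := fun k => by simp only [hg']; split_ifs; exacts [hG0 k, le_rfl]
  have hg's : Summable g' := hGs.of_nonneg_of_le hg'0 fun k => by simp only [hg']; split_ifs; exacts [le_rfl, hG0 k]
  have hg'm : ∑' k, g' k = ∑' j, G (j + m) := by
    rw [← hg's.sum_add_tsum_nat_add m, sum_eq_zero fun k hk => ?_, zero_add]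
    · refine tsum_congr fun j => ?_; simp only [hg']; rw [if_pos (Nat.le_add_left _ _)]
    · simp only [hg']; rw [if_neg (not_le.2 (mem_range.1 hk))]
  have hinner : ∀ t : HV, ∑ k ∈ range #((rotStripV H Wd).erase wOut),
      (if 3 * (Wd : ℤ) - |xX v - 3| ≤ 2 * ((k : ℤ) + 1) then (#(pieceL H (t, k)) : ℝ) * hexCriticalFugacity ^ k else 0) ≤
        ∑' j, G (j + m) := by
    intro t
    rw [← hg'm]
    refine (sum_le_sum fun k _ => ?_).trans (hg's.sum_le_tsum _ fun k _ => hg'0 k)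
    simp only [hg']
    split_ifs with h1 h2
    · exact hpiece (t, k)
    · exfalso; omega
    · exact hG0 k
    · exact le_rfl
  unfold tailMassL idxL
  rw [sum_filter, sum_product]
  calc ∑ t ∈ (HV.nbrs v).toFinset, ∑ k ∈ range #((rotStripV H Wd).erase wOut),
        (if 3 * (Wd : ℤ) - |xX v - 3| ≤ 2 * (((t, k).2 : ℤ) + 1) then (#(pieceL H (t, k)) : ℝ) * hexCriticalFugacity ^ (t, k).2 else 0)
      ≤ ∑ t ∈ (HV.nbrs v).toFinset, ∑' j, G (j + m) := sum_le_sum fun t _ => hinner t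
    _ = #((HV.nbrs v).toFinset) * ∑' j, G (j + m) := by rw [sum_const, nsmul_eq_mul]
    _ ≤ 3 * ∑' j, G (j + m) := by
        refine mul_le_mul_of_nonneg_right ?_ (tsum_nonneg fun j => hG0 _)
        have h1 := List.toFinset_card_le (HV.nbrs v)
        rw [nbrs_length] at h1
        exact_mod_cast h1

/-! ### Assembly: `E^{⊥}_{H,W}(x_c, y) → 0` -/

/-- «the top vertex of `π` is at lateral distance `≥ 2m + 1` from the lateral lines of width `W`». [cite: Beaton2014RotatedHoneycomb, §4] -/
private def farL (m Wd : ℕ) (π : List HV) : Prop := 2 * (m : ℤ) + 1 ≤ 3 * (Wd : ℤ) - |xX (finalDart π).1 - 3|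

/-- `farL` is decidable. [folklore] -/
private instance (m Wd : ℕ) : DecidablePred (farL m Wd) := fun π => by unfold farL; infer_instance

/-- **The estimate** (`H = H₀ + 1`, `W ≥ 1`, every `m`): with `G := F[0 ↦ 1]`, `Ψ_m := Σ_j G(j+m)`, `B_W := B^{⊥,→}_{H,W}(y) ≤ K`,
`E^{⊥}_{H,W}(y) ≤ E^{⊥}_{H₀,W}(1) + 3Ψ_m·K + 3Ψ_0·(B_W − B_{W−m−1})`: far heads meet a small slab tail, near heads are top walks of
`D(H,W)` that are not walks of `D(H, W−m−1)`. [cite: Beaton2014RotatedHoneycomb, §4, proof of Corollary 13 via Corollary 10 and the cut of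
Proposition 11] -/
private theorem lat_estimate {H₀ : ℕ} {F : ℕ → ℝ}
    (hF : ∀ (s : HV) (k : ℕ), (#(slabSAWs (H₀ + 1 - 1) s k) : ℝ) * hexCriticalFugacity ^ k ≤ F k) (hFs : Summable F)
    {y K : ℝ} (hy : 0 ≤ y) (hK : ∀ Wd : ℕ, rotGFy ((rotStripV (H₀ + 1) Wd).erase wOut) (H₀ + 1) (IsRotTopDart (H₀ + 1)) y ≤ K)
    (m Wd : ℕ) (hWd : 1 ≤ Wd) :
    rotGFy ((rotStripV (H₀ + 1) Wd).erase wOut) (H₀ + 1) (IsRotLatDart (H₀ + 1) Wd) y ≤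
      rotGF ((rotStripV H₀ Wd).erase wOut) (IsRotLatDart H₀ Wd) +
        3 * (∑' j, Function.update F 0 1 (j + m)) * K +
        3 * (∑' j, Function.update F 0 1 (j + 0)) *
          (rotGFy ((rotStripV (H₀ + 1) Wd).erase wOut) (H₀ + 1) (IsRotTopDart (H₀ + 1)) y -
            rotGFy ((rotStripV (H₀ + 1) (Wd - (m + 1))).erase wOut) (H₀ + 1) (IsRotTopDart (H₀ + 1)) y) := by
  have hx := hexCriticalFugacity_pos_lt_one
  have hH : 1 ≤ H₀ + 1 := by omega
  have hG0 : ∀ k, 0 ≤ Function.update F 0 1 k := fun k => by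
    by_cases hk : k = 0
    · subst hk; simp
    · rw [Function.update_of_ne hk]
      exact (mul_nonneg (Nat.cast_nonneg _) (pow_nonneg hx.1.le _)).trans (hF hvOrigin k)
  have hΨ0 : ∀ m, 0 ≤ ∑' j, Function.update F 0 1 (j + m) := fun m => tsum_nonneg fun j => hG0 _
  have hf0 : ∀ P : List HV, 0 ≤ hexCriticalFugacity ^ mwLen P * y ^ topContacts (H₀ + 1) P := fun P =>
    mul_nonneg (pow_nonneg hx.1.le _) (pow_nonneg hy _)
  have hmemT : ∀ π ∈ (midWalks ((rotStripV (H₀ + 1) Wd).erase wOut)).filter (fun P => IsRotTopDart (H₀ + 1) (finalDart P)),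
      IsMidWalk ((rotStripV (H₀ + 1) Wd).erase wOut) π ∧ IsRotTopDart (H₀ + 1) (finalDart π) := fun π hπ => by
    have h := mem_filter.1 hπ; exact ⟨mem_midWalks_iff.1 h.1, h.2⟩
  -- step 1: no contact + the cut
  have h1 := lat_cut_le (H := H₀ + 1) hH hWd hy
  rw [rotGFy_lat_eq_add]
  -- step 2: split the heads into far and near
  rw [← sum_filter_add_sum_filter_not (((midWalks ((rotStripV (H₀ + 1) Wd).erase wOut)).filter
    (fun P => IsRotTopDart (H₀ + 1) (finalDart P)))) (farL m Wd)] at h1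
  -- far heads: tail mass ≤ 3 Ψ_m, total head mass ≤ K
  have hfarle : ∑ π ∈ ((midWalks ((rotStripV (H₀ + 1) Wd).erase wOut)).filter
        (fun P => IsRotTopDart (H₀ + 1) (finalDart P))).filter (farL m Wd),
      hexCriticalFugacity ^ mwLen π * y ^ topContacts (H₀ + 1) π * tailMassL (H₀ + 1) Wd (finalDart π).1 ≤
        3 * (∑' j, Function.update F 0 1 (j + m)) * K := by
    calc ∑ π ∈ ((midWalks ((rotStripV (H₀ + 1) Wd).erase wOut)).filter
            (fun P => IsRotTopDart (H₀ + 1) (finalDart P))).filter (farL m Wd),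
          hexCriticalFugacity ^ mwLen π * y ^ topContacts (H₀ + 1) π * tailMassL (H₀ + 1) Wd (finalDart π).1
        ≤ ∑ π ∈ ((midWalks ((rotStripV (H₀ + 1) Wd).erase wOut)).filter
            (fun P => IsRotTopDart (H₀ + 1) (finalDart P))).filter (farL m Wd),
          hexCriticalFugacity ^ mwLen π * y ^ topContacts (H₀ + 1) π * (3 * ∑' j, Function.update F 0 1 (j + m)) :=
          sum_le_sum fun π hπ => mul_le_mul_of_nonneg_left (tailMassL_le hF hFs (mem_filter.1 hπ).2) (hf0 π)
      _ = 3 * (∑' j, Function.update F 0 1 (j + m)) *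
          ∑ π ∈ ((midWalks ((rotStripV (H₀ + 1) Wd).erase wOut)).filter
            (fun P => IsRotTopDart (H₀ + 1) (finalDart P))).filter (farL m Wd),
            hexCriticalFugacity ^ mwLen π * y ^ topContacts (H₀ + 1) π := by rw [← sum_mul]; ring
      _ ≤ 3 * (∑' j, Function.update F 0 1 (j + m)) * K := by
          refine mul_le_mul_of_nonneg_left ?_ (by linarith [hΨ0 m])
          exact (sum_le_sum_of_subset_of_nonneg (filter_subset _ _) fun π _ _ => hf0 π).trans (hK Wd)
  -- near heads: tail mass ≤ 3 Ψ_0, and they are not walks of `D(H, W − m − 1)`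
  have hsub : (midWalks ((rotStripV (H₀ + 1) (Wd - (m + 1))).erase wOut)).filter
        (fun P => IsRotTopDart (H₀ + 1) (finalDart P)) ⊆
      ((midWalks ((rotStripV (H₀ + 1) Wd).erase wOut)).filter (fun P => IsRotTopDart (H₀ + 1) (finalDart P))).filter
        (farL m Wd) := by
    intro π hπ
    obtain ⟨p1, p2⟩ := mem_filter.1 hπ
    have hlt := topV_lt (Wd := Wd - (m + 1)) hH (mem_midWalks_iff.1 p1) p2
    refine mem_filter.2 ⟨mem_filter.2 ⟨midWalks_mono (erase_subset_erase _ (rotStripV_mono_width (Nat.sub_le _ _))) p1, p2⟩, ?_⟩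
    unfold farL
    rcases Nat.lt_or_ge Wd (m + 1) with hmW | hmW
    · rw [Nat.sub_eq_zero_of_le hmW.le] at hlt; push_cast at hlt
      linarith [abs_nonneg (xX (finalDart π).1 - 3)]
    · rw [Nat.cast_sub hmW] at hlt; push_cast at hlt; linarith
  have hnearle : ∑ π ∈ ((midWalks ((rotStripV (H₀ + 1) Wd).erase wOut)).filter
        (fun P => IsRotTopDart (H₀ + 1) (finalDart P))).filter (fun π => ¬ farL m Wd π),
      hexCriticalFugacity ^ mwLen π * y ^ topContacts (H₀ + 1) π * tailMassL (H₀ + 1) Wd (finalDart π).1 ≤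
        3 * (∑' j, Function.update F 0 1 (j + 0)) *
          (rotGFy ((rotStripV (H₀ + 1) Wd).erase wOut) (H₀ + 1) (IsRotTopDart (H₀ + 1)) y -
            rotGFy ((rotStripV (H₀ + 1) (Wd - (m + 1))).erase wOut) (H₀ + 1) (IsRotTopDart (H₀ + 1)) y) := by
    have hle1 : ∑ π ∈ ((midWalks ((rotStripV (H₀ + 1) Wd).erase wOut)).filter
          (fun P => IsRotTopDart (H₀ + 1) (finalDart P))).filter (fun π => ¬ farL m Wd π),
        hexCriticalFugacity ^ mwLen π * y ^ topContacts (H₀ + 1) π * tailMassL (H₀ + 1) Wd (finalDart π).1 ≤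
          3 * (∑' j, Function.update F 0 1 (j + 0)) *
            ∑ π ∈ ((midWalks ((rotStripV (H₀ + 1) Wd).erase wOut)).filter
              (fun P => IsRotTopDart (H₀ + 1) (finalDart P))).filter (fun π => ¬ farL m Wd π),
              hexCriticalFugacity ^ mwLen π * y ^ topContacts (H₀ + 1) π := by
      rw [mul_sum]
      refine sum_le_sum fun π hπ => ?_
      obtain ⟨a1, a2⟩ := hmemT π (mem_filter.1 hπ).1
      have hlt := topV_lt (Wd := Wd) hH a1 a2
      have htm := tailMassL_le (Wd := Wd) hF hFs (m := 0) (v := (finalDart π).1) (by push_cast; linarith)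
      calc hexCriticalFugacity ^ mwLen π * y ^ topContacts (H₀ + 1) π * tailMassL (H₀ + 1) Wd (finalDart π).1
          ≤ hexCriticalFugacity ^ mwLen π * y ^ topContacts (H₀ + 1) π * (3 * ∑' j, Function.update F 0 1 (j + 0)) :=
            mul_le_mul_of_nonneg_left htm (hf0 π)
        _ = _ := by ring
    have e1 := sum_filter_add_sum_filter_not ((midWalks ((rotStripV (H₀ + 1) Wd).erase wOut)).filter
      (fun P => IsRotTopDart (H₀ + 1) (finalDart P))) (farL m Wd) fun π => hexCriticalFugacity ^ mwLen π * y ^ topContacts (H₀ + 1) π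
    have e3 := sum_le_sum_of_subset_of_nonneg hsub fun π _ _ => hf0 π
    refine hle1.trans (mul_le_mul_of_nonneg_left ?_ (by linarith [hΨ0 0]))
    rw [rotGFy, rotGFy, ← e1]
    linarith
  linarith

/-- **Face Y3 of door R96 reduced to the slab face** (`H ≥ 1`, `y ≥ 0`, `B^{⊥,→}_{H,W}(y) ≤ K` for all `W`):
`RotSlabWalksSummable (H − 1) → E^{⊥}_{H,W}(x_c, y) → 0` as `W → ∞`; i.e. Beaton's Corollary 13 `E_T(x_c, y) = 0` at general `y`,
conditionally on the finiteness of the slab generating function (Corollary 10), by the cut at the last surface contact.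
[cite: Beaton2014RotatedHoneycomb, §4, Corollary 13 (arXiv v3 p. 17), via Corollary 10 (p. 16) and the proof of Proposition 11] -/
theorem rotELimZeroY_of_slabSummable {H : ℕ} (hH : 1 ≤ H) (hslab : RotSlabWalksSummable (H - 1)) {y K : ℝ} (hy : 0 ≤ y)
    (hK : ∀ Wd : ℕ, rotGFy ((rotStripV H Wd).erase wOut) H (IsRotTopDart H) y ≤ K) :
    Tendsto (fun Wd : ℕ => rotGFy ((rotStripV H Wd).erase wOut) H (IsRotLatDart H Wd) y) atTop (𝓝 0) := by
  obtain ⟨H₀, rfl⟩ : ∃ H₀, H = H₀ + 1 := ⟨H - 1, by omega⟩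
  obtain ⟨F, hFs, hF⟩ := hslab
  have hx := hexCriticalFugacity_pos_lt_one
  -- the ingredients' limits
  have hE0lim : Tendsto (fun Wd : ℕ => rotGF ((rotStripV H₀ Wd).erase wOut) (IsRotLatDart H₀ Wd)) atTop (𝓝 0) := by
    rcases Nat.eq_zero_or_pos H₀ with h | h
    · subst h; simp only [rotGF_lat_height_zero]; exact tendsto_const_nhds
    · exact tendsto_rotStripLat_zero h
  have hBlim : Tendsto (fun Wd : ℕ => rotGFy ((rotStripV (H₀ + 1) Wd).erase wOut) (H₀ + 1) (IsRotTopDart (H₀ + 1)) y) atTop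
      (𝓝 (⨆ Wd : ℕ, rotGFy ((rotStripV (H₀ + 1) Wd).erase wOut) (H₀ + 1) (IsRotTopDart (H₀ + 1)) y)) :=
    tendsto_atTop_ciSup (rotGFy_top_monotone (H₀ + 1) hy) ⟨K, by rintro _ ⟨Wd, rfl⟩; exact hK Wd⟩
  have hΨlim : Tendsto (fun m : ℕ => ∑' j, Function.update F 0 1 (j + m)) atTop (𝓝 0) := tendsto_sum_nat_add _
  -- conclusion: an `ε`-argument on the estimate `lat_estimate`
  rw [tendsto_order]
  refine ⟨fun a ha => Eventually.of_forall fun Wd => ha.trans_le (rotGFy_nonneg _ _ _ hy), fun ε hε => ?_⟩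
  have hm : ∀ᶠ m : ℕ in atTop, 3 * (∑' j, Function.update F 0 1 (j + m)) * K < ε := by
    have : Tendsto (fun m : ℕ => 3 * (∑' j, Function.update F 0 1 (j + m)) * K) atTop (𝓝 (3 * 0 * K)) :=
      (hΨlim.const_mul 3).mul_const K
    rw [mul_zero, zero_mul] at this
    exact (tendsto_order.1 this).2 ε hε
  obtain ⟨m, hm⟩ := hm.exists
  have h2 := (hE0lim.add (tendsto_const_nhds :
      Tendsto (fun _ : ℕ => 3 * (∑' j, Function.update F 0 1 (j + m)) * K) atTop (𝓝 _))).add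
    ((hBlim.sub (hBlim.comp (tendsto_sub_atTop_nat (m + 1)))).const_mul (3 * ∑' j, Function.update F 0 1 (j + 0)))
  simp only [sub_self, mul_zero, add_zero, zero_add] at h2
  filter_upwards [(tendsto_order.1 h2).2 ε hm, eventually_ge_atTop 1] with Wd hWd hWd1
  exact (lat_estimate hF hFs hy hK m Wd hWd1).trans_lt hWd

end Literature.Probability.RandomPlanarGeometry.SAW.HV
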